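import Literature.AlgebraicGeometry.Frobenioids.PerfectionLifting
import HarnessLib

/-!
# Frobenioids I, Proposition 3.2 (iii), "`C^pf` is a Frobenioid": Definition 1.3 (ii) for `C^pf` —
# arrows of Frobenius type of every degree out of every object, and their essential uniqueness (PROOFS)

Mochizuki, *The geometry of Frobenioids I: the general theory*, Kyushu J. Math. **62** (2008),
Definition 1.3 (ii) p. 24, Definition 3.1 (iii) p. 57, Proposition 3.2 (iii) p. 59
[cite: MochizukiFrdI2008, Prop. 3.2 (iii) p.59]: "`C^pf`, equipped with the functor `C^pf → F_{Φ^pf}` …, is a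
Frobenioid". This file is one clause-group of that verification (abc-iut cell, row
`FrdI:Prop3.2(iii)-frobenioid`, co-worked by seats abc-iut-L1-d1 / abc-iut-L1-d9; assembly of
`IsFrobenioid (Perfection.ops hF).toFunctor` in a later file): Definition 1.3 (ii) for `C^pf`, at the level
of the operations `Perfection.ops hF`.

* `isCoAngular_mk_of`, `isFrobeniusType_mk_of`, `degFr_mk_eq`: a perfected morphism whose representative
  is co-angular (resp. of Frobenius type) in `C` is so in `C^pf` (all its transports are Frobenius
  conjugates, Prop. 1.10 (i)), with the same Frobenius degree;
* `ii_exists_perfection`: out of `(A, m)` there is an arrow of Frobenius type of every degree `n`, namely the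
  class at level `(1, 1)` of the conjugate of the chosen `A → A^{(n)}`, landing in `(A^{(n)}, m)`;
* `ii_unique_perfection`: two arrows of Frobenius type of the same degree out of `X` have isomorphic
  codomains under `X` — by the essential uniqueness `exists_iso_comp_powerMap` both are power maps up to
  isomorphisms of `X`, and the resulting isomorphism `(B, k·d) ≅ (B′, k′·d)` DESCENDS along the power maps by
  the conjugation bijection (`exists_rep_scaled`, `conj_powerMap_mk`) (for `C` of Frobenius-isotropic type,
  the standing hypothesis of §3).
No new definitions.
-/

namespace Literature.AlgebraicGeometry.Frobenioids

namespace PreFrobenioid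

namespace Perfection

open CategoryTheory Opposite

universe w v v' u u'

variable {D : Type u} [Category.{v} D] {Φ : Dᵒᵖ ⥤ CommMonCat.{w}}
  {C : Type u'} [Category.{v'} C] {F : C ⥤ ElemFrobenioid Φ} {hF : IsFrobenioid F}

/-! ### Classes of co-angular / Frobenius-type representatives -/

/-- A perfected morphism represented by a co-angular arrow of `C` is co-angular in `C^pf`: all its transports
are Frobenius conjugates of the representative (Prop. 1.10 (i): "if `φ` is co-angular then so is `φ′`").
[cite: MochizukiFrdI2008, Prop. 3.2 (ii) p.59] -/
theorem isCoAngular_mk_of {X Y : Perfection hF} (r : Rep X Y) (hr : PreFrobenioid.IsCoAngular F r.hom) :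
    (ops hF).IsCoAngular (X := X) (Y := Y) (Hom.mk r) :=
  isCoAngular_mk r fun L h =>
    IsCoAngular.frobeniusConjugate hF hr (Level.lift_spec r.L L h r.hom) (isFrobeniusType_frobTrans hF _ h.1)
      (isFrobeniusType_frobTrans hF _ h.2) (Level.degFr_eq r.L L h)

/-- The Frobenius degree of a class is that of its representative. [cite: MochizukiFrdI2008, Prop. 3.2 (i) p.58] -/
theorem degFr_mk_eq {X Y : Perfection hF} (r : Rep X Y) :
    (ops hF).degFr (A := X) (B := Y) (Hom.mk r) = PreFrobenioid.degFr F r.hom := rfl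

/-- A perfected morphism represented by an arrow of Frobenius type of `C` is of Frobenius type in `C^pf`
(co-angular by `isCoAngular_mk_of`; isometric and a base-isomorphism by `div_eq_one_iff`, `isIso_base_hom_iff`).
[cite: MochizukiFrdI2008, Prop. 3.2 (ii) p.59] -/
theorem isFrobeniusType_mk_of {X Y : Perfection hF} (r : Rep X Y) (hr : IsFrobeniusType F r.hom) :
    (ops hF).IsFrobeniusType (X := X) (Y := Y) (Hom.mk r) :=
  ⟨⟨isCoAngular_mk_of r hr.1.1, (div_eq_one_iff r).mpr hr.1.2⟩, (isIso_base_hom_iff r).mp hr.2⟩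

/-! ### Definition 1.3 (ii) for `C^pf`: existence -/

/-- **Def. 1.3 (ii), existence, for `C^pf`**: for every object `(A, m)` and every `n` there is an arrow of
Frobenius type of Frobenius degree `n` out of `(A, m)` — the class at level `(1, 1)` of the conjugate
`A^{(1)} → (A^{(n)})^{(1)}` of the chosen `A → A^{(n)}`, an arrow `(A, m) → (A^{(n)}, m)`.
[cite: MochizukiFrdI2008, Prop. 3.2 (iii) p.59] -/
theorem ii_exists_perfection (hF : IsFrobenioid F) (X : Perfection hF) (n : ℕ+) :
    ∃ (Y : Perfection hF) (φ : X ⟶ Y), (ops hF).IsFrobeniusType φ ∧ (ops hF).degFr φ = n := by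
  obtain ⟨A, m⟩ := X
  let r : Rep (⟨A, m⟩ : Perfection hF) ⟨frobPow hF A n, m⟩ := ⟨⟨1, 1, rfl⟩, (toPfRep hF (frob hF A n)).hom⟩
  have hdeg1 : PreFrobenioid.degFr F (frob hF A 1) = PreFrobenioid.degFr F (frob hF (frobPow hF A n) 1) := by
    rw [degFr_frob, degFr_frob]
  have hr : IsFrobeniusType F r.hom :=
    IsFrobeniusType.frobeniusConjugate hF (isFrobeniusType_frob hF A n) (frob_toPfRep (frob hF A n))
      (isFrobeniusType_frob hF A 1) (isFrobeniusType_frob hF _ 1) hdeg1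
  refine ⟨⟨frobPow hF A n, m⟩, Hom.mk r, isFrobeniusType_mk_of r hr, ?_⟩
  rw [degFr_mk_eq]
  change PreFrobenioid.degFr F (toPfRep hF (frob hF A n)).hom = n
  rw [degFr_frobeniusConjugate (frob_toPfRep (frob hF A n)) hdeg1, degFr_frob]

/-! ### Definition 1.3 (ii) for `C^pf`: essential uniqueness -/

section Descend

variable {B B' : C} {k k' : ℕ+} (d : ℕ+)

/-- **Isomorphisms descend along the power maps**: an isomorphism `ι : (B, k·d) ≅ (B′, k′·d)` of `C^pf` is the
conjugate, along the `d`-th power maps, of an isomorphism `(B, k) ≅ (B′, k′)` (the conjugation bijection of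
`PerfectionLifting.lean`: every arrow upstairs is a re-read arrow downstairs, `exists_rep_scaled`, and the
power maps are epimorphisms). [cite: MochizukiFrdI2008, Prop. 3.2 (iii) p.59] -/
theorem exists_iso_descend (ι : (⟨B, k * d⟩ : Perfection hF) ≅ ⟨B', k' * d⟩) :
    ∃ β : (⟨B, k⟩ : Perfection hF) ≅ ⟨B', k'⟩,
      ι.hom ≫ Hom.mk (⟨⟨1, d, mul_one _⟩, frobTrans hF B' (one_dvd d)⟩ : Rep (⟨B', k' * d⟩ : Perfection hF) ⟨B', k'⟩) =
        Hom.mk (⟨⟨1, d, mul_one _⟩, frobTrans hF B (one_dvd d)⟩ : Rep (⟨B, k * d⟩ : Perfection hF) ⟨B, k⟩) ≫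
          β.hom := by
  -- read `ι.hom` and `ι.inv` as arrows downstairs
  obtain ⟨u, hu⟩ := Hom.mk_surjective ι.hom
  obtain ⟨u', hu'⟩ := Hom.mk_surjective ι.inv
  obtain ⟨s, rfl⟩ := exists_rep_scaled d u
  obtain ⟨s', rfl⟩ := exists_rep_scaled d u'
  have hs := conj_powerMap_mk d s
  have hs' := conj_powerMap_mk d s'
  rw [hu] at hs
  rw [hu'] at hs'
  -- `Hom.mk s ≫ Hom.mk s' = 𝟙` and conversely, by cancelling the (epimorphic) power maps
  haveI := epi_hom (Hom.mk (⟨⟨1, d, mul_one _⟩, frobTrans hF B (one_dvd d)⟩ : Rep (⟨B, k * d⟩ : Perfection hF) ⟨B, k⟩))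
  haveI := epi_hom (Hom.mk (⟨⟨1, d, mul_one _⟩, frobTrans hF B' (one_dvd d)⟩ :
    Rep (⟨B', k' * d⟩ : Perfection hF) ⟨B', k'⟩))
  have h₁ : (Hom.mk s ≫ Hom.mk s' : (⟨B, k⟩ : Perfection hF) ⟶ ⟨B, k⟩) = 𝟙 _ := by
    rw [← cancel_epi (Hom.mk (⟨⟨1, d, mul_one _⟩, frobTrans hF B (one_dvd d)⟩ :
      Rep (⟨B, k * d⟩ : Perfection hF) ⟨B, k⟩)), Category.comp_id, ← Category.assoc, ← hs, Category.assoc,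
      ← hs', ← Category.assoc, ι.hom_inv_id, Category.id_comp]
  have h₂ : (Hom.mk s' ≫ Hom.mk s : (⟨B', k'⟩ : Perfection hF) ⟶ ⟨B', k'⟩) = 𝟙 _ := by
    rw [← cancel_epi (Hom.mk (⟨⟨1, d, mul_one _⟩, frobTrans hF B' (one_dvd d)⟩ :
      Rep (⟨B', k' * d⟩ : Perfection hF) ⟨B', k'⟩)), Category.comp_id, ← Category.assoc, ← hs', Category.assoc,
      ← hs, ← Category.assoc, ι.inv_hom_id, Category.id_comp]
  exact ⟨⟨Hom.mk s, Hom.mk s', h₁, h₂⟩, hs⟩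

end Descend

/-- **Def. 1.3 (ii), essential uniqueness, for `C^pf`** (for `C` of Frobenius-isotropic type): two arrows of
Frobenius type of the same Frobenius degree out of an object of `C^pf` have isomorphic codomains under it.
(Both are `d`-th power maps up to isomorphisms of the domain, `exists_iso_comp_powerMap`; the comparison
isomorphism `(B, k·d) ≅ (B′, k′·d)` descends along the power maps, `exists_iso_descend`.)
[cite: MochizukiFrdI2008, Prop. 3.2 (iii) p.59] -/
theorem ii_unique_perfection (hF : IsFrobenioid F) (hiso : IsOfType (IsFrobeniusIsotropic F))
    ⦃X Y Y' : Perfection hF⦄ (φ : X ⟶ Y) (ψ : X ⟶ Y') (hφ : (ops hF).IsFrobeniusType φ)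
    (hψ : (ops hF).IsFrobeniusType ψ) (hd : (ops hF).degFr φ = (ops hF).degFr ψ) :
    ∃ β : Y ≅ Y', φ ≫ β.hom = ψ := by
  obtain ⟨B, k⟩ := Y
  obtain ⟨B', k'⟩ := Y'
  obtain ⟨d, hdψ⟩ : ∃ d, (ops hF).degFr ψ = d := ⟨_, rfl⟩
  obtain ⟨e, he, rfl⟩ := exists_iso_comp_powerMap hiso φ hφ (hd.trans hdψ)
  obtain ⟨e', he', rfl⟩ := exists_iso_comp_powerMap hiso ψ hψ hdψ
  haveI := he
  haveI := he'
  obtain ⟨β, hβ⟩ := exists_iso_descend d ((asIso e).symm ≪≫ asIso e')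
  refine ⟨β, ?_⟩
  rw [Category.assoc, ← hβ]
  change e ≫ (inv e ≫ e') ≫ _ = _
  rw [← Category.assoc, ← Category.assoc, IsIso.hom_inv_id, Category.id_comp]

end Perfection

end PreFrobenioid

end Literature.AlgebraicGeometry.Frobenioids
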